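import Summits.CriticalPhenomena.SAWScalingLimit.Theorems.SAWDevelopingMapObservableToSLETypeLadderCarvedReductionSandwich
import Summits.CriticalPhenomena.SAWScalingLimit.Theorems.ObservableToSLE.Negative.Identification
import Literature.Probability.RandomPlanarGeometry.HullSubdomainPullback
import Literature.Probability.RandomPlanarGeometry.RestrictionHulls
import HarnessLib

/-!
# Crux `SAWDevelopingMap.ObservableToSLE` (stmt-CriticalPhenomena-10472), line `six-class-type-ladder`,
stub T2b″ `stub_carvedReduction_squeezeSolid`: piece (G5/G6) THE RATIO SQUEEZE
(ARL″ once, in the outer approximant, + the exact sandwich ⇒ the carved mass clause)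

Landing target:
`Summits/CriticalPhenomena/SAWScalingLimit/Theorems/SAWDevelopingMapObservableToSLETypeLadderCarvedReductionSqueezeRatio.lean`
(`--supports stmt-CriticalPhenomena-10472`).

This is the BOOKKEEPING half of the repaired squeeze `ARL″ → MovingCarvingSqueezeP _`: it consumes
the two-piece admissible restriction limit ARL″ exactly once and turns a SQUEEZE PACKAGE into the
last clause of the moving-carving squeeze.  The package (produced by the geometric half) consists of

* a two-piece flat Dobrushin domain `E` (the outer Jordan approximant of the pinned carved domains),
  a hull subdomain `M` of `E` (the inner approximant), a chordal uniformizer `φ` of `E`, a restriction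
  datum `(Φ, d)` of the pulled-back hull with `1 - ε' < d^{5/8}`;
* `δ`-indexed families `N ⊇ Λ'` satisfying the admissibility block of ARL″ for `(E, M)` (common free
  threshold `m₀` at `E.pt 0`, separate free thresholds `m₁, m₁'` at `E.pt 1`), compact exhaustions and
  endpoint limits;
* per index `j` of the mesh sequence `s j → 0⁺`: the carved law `carvedLaw Ω (s j) (U j) (u j) (v j)`
  is a probability measure, the cell `Λ'' j` is the lattice translate by `x j` of `Λ' (s j)`, it misses
  `U j`, has no bad edge, contains the gate vertex `u j`, the gate mid-edges are the translates of
  `a (s j)`, `b (s j)`, and EVERY `U j`-avoiding walk of `Ω_{s j}` from `u j` stays, after translating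
  back by `x j`, inside `N (s j)` (the outer containment), which misses the translates of `pu j`, `pv j`.

Conclusion (`stub_carvedReduction_ratioSqueeze`): eventually in `j`,
`1 - ε' ≤ P^{carved}_j(walk ⊆ Λ'' j)`.  Proof: ARL″ gives `Z_{Λ'(δ)}/Z_{N(δ)} → d^{5/8}` along `𝓝[>] 0`,
hence along `s`; eventually the ratio exceeds `1 - ε'`; and the landed exact sandwich
`TypeLadder.stub_carvedReduction_sandwich` (p126115) bounds the ratio at `δ = s j` by the carved
mass of the cell.  The level lemma `stub_carvedReduction_ratioSqueeze_level` converts the frame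
bound `1 - ε'/2 ≤ d ≤ 1` (twin piece `Squeeze.stub_carvedReduction_derivFrame`, p129409) into the
strict `1 - ε' < d^{5/8}` used here.

Sources: G. Lawler, O. Schramm, W. Werner, J. Amer. Math. Soc. 16 (2003) Thm. 6.1, (2.4);
G. Lawler, O. Schramm, W. Werner, Proc. Sympos. Pure Math. 72 (2004) §3.4.
-/

noncomputable section

open scoped BigOperators Topology NNReal ENNReal Classical
open Filter Set MeasureTheory Metric
open Literature.Probability.LatticeModels (HexVertex hexGraph hexCenter triZeta triEmbed Site polyline)
open Literature.Probability.RandomPlanarGeometry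
open Literature.Probability.RandomPlanarGeometry.SAW
open UpperHalfPlane (upperHalfPlaneSet)

namespace Summit.CriticalPhenomena.SAWScalingLimit.Theorems.ObservableToSLE.TypeLadder

open Summit.CriticalPhenomena.SAWScalingLimit.Theorems.ObservableToSLER.BridgeGate
open Summit.CriticalPhenomena.SAWScalingLimit.Theorems.ObservableToSLE.Negative (finite_hexDomainSAW)

/-- **Registered sub-goal `stub_carvedReduction_ratioSqueeze_level`** (the LEVEL of the ratio
squeeze): if `0 < ε'` and the restriction derivative satisfies `0 < d ≤ 1` and `1 - ε'/2 ≤ d`, then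
`1 - ε' < d^{5/8}` — the strict bound under which the ratio limit `d^{5/8}` of ARL″ certifies the
carved mass `1 - ε'` eventually (`d ≤ d^{5/8}` on `(0, 1]`). -/
theorem stub_carvedReduction_ratioSqueeze_level :
    ∀ (d ε' : ℝ), 0 < ε' → 0 < d → d ≤ 1 → 1 - ε' / 2 ≤ d → 1 - ε' < d ^ ((5 : ℝ) / 8) := by
  intro d ε' hε' hd0 hd1 hd
  have hle : d ≤ d ^ ((5 : ℝ) / 8) := by
    have h := Real.rpow_le_rpow_of_exponent_ge hd0 hd1 (show (5 : ℝ) / 8 ≤ 1 by norm_num)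
    rwa [Real.rpow_one] at h
  linarith

/-- **THE RATIO SQUEEZE** (piece (G5/G6) of T2b″): ARL″, applied ONCE to the outer approximant `E`
and its hull subdomain `M` with the admissible pair `N ⊇ Λ'`, together with the exact sandwich
`Z_{Λ'(s j)}/Z_{N(s j)} ≤ P^{carved}_j(⊆ Λ'' j)` (`stub_carvedReduction_sandwich`) at every index of a
mesh sequence `s j → 0⁺` whose cells `Λ'' j` are the translates of `Λ' (s j)` and whose carved walks
are contained in the translates of `N (s j)`, yields the carved-mass clause of the moving-carving
squeeze: eventually `1 - ε' ≤ P^{carved}_j(walk ⊆ Λ'' j)`, provided `1 - ε' < d^{5/8}`.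
[cite: LawlerSchrammWerner2003Restriction, Thm. 6.1 (p. 23)] -/
theorem stub_carvedReduction_ratioSqueeze :
    (∀ (D D' : DobrushinDomain) (ρ : ℝ) (φ : ConformalEquiv upperHalfPlaneSet D.carrier)
      (Φ : ConformalEquiv (upperHalfPlaneSet \ φ.pullbackHull D') upperHalfPlaneSet) (d : ℝ)
      (Λ Λ' : ℝ → Finset HexVertex) (m₀ m₁ m₁' : ℝ → ℤ) (a b : ℝ → Sym2 HexVertex),
      (0 < ρ ∧ ∀ i : Fin 2, D.carrier ∩ ball (D.pt i) ρ = {z : ℂ | (D.pt i).im < z.im} ∩ ball (D.pt i) ρ) →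
      D.IsHullSubdomain D' → D.IsChordalUniformizing φ →
      IsRestrictionMap (φ.pullbackHull D') Φ → HasRestrictionDeriv (φ.pullbackHull D') Φ d →
      (∀ᶠ δ : ℝ in 𝓝[>] 0,
        Λ' δ ⊆ Λ δ ∧ hexDomainSimplyConnected (Λ δ) ∧ hexDomainSimplyConnected (Λ' δ) ∧
        (hexGraph.induce (↑(Λ δ) : Set HexVertex)).Preconnected ∧
        (hexGraph.induce (↑(Λ' δ) : Set HexVertex)).Preconnected ∧
        a δ ∈ hexDomainBoundary (Λ δ) ∧ b δ ∈ hexDomainBoundary (Λ δ) ∧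
        a δ ∈ hexDomainBoundary (Λ' δ) ∧ b δ ∈ hexDomainBoundary (Λ' δ) ∧
        Nonempty (HexMidEdgeSAW (Λ' δ) (a δ) (b δ)) ∧
        (∀ v ∈ Λ δ, (δ : ℂ) * hexCenter v ∈ D.carrier) ∧
        (∀ v ∈ Λ' δ, (δ : ℂ) * hexCenter v ∈ D'.carrier) ∧
        (∀ v : HexVertex, (δ : ℂ) * hexCenter v ∈ ball (D.pt 0) ρ →
          ((v ∈ Λ δ ↔ m₀ δ ≤ v.1 1) ∧ (v ∈ Λ' δ ↔ m₀ δ ≤ v.1 1))) ∧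
        (∀ v : HexVertex, (δ : ℂ) * hexCenter v ∈ ball (D.pt 1) ρ →
          ((v ∈ Λ δ ↔ m₁ δ ≤ v.1 1) ∧ (v ∈ Λ' δ ↔ m₁' δ ≤ v.1 1)))) →
      (∀ K : Set ℂ, IsCompact K → K ⊆ D.carrier →
        ∀ᶠ δ : ℝ in 𝓝[>] 0, ∀ v : HexVertex, (δ : ℂ) * hexCenter v ∈ K → v ∈ Λ δ) →
      (∀ K : Set ℂ, IsCompact K → K ⊆ D'.carrier →
        ∀ᶠ δ : ℝ in 𝓝[>] 0, ∀ v : HexVertex, (δ : ℂ) * hexCenter v ∈ K → v ∈ Λ' δ) →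
      Tendsto (fun δ : ℝ => (δ : ℂ) * hexMidpoint (a δ)) (𝓝[>] 0) (𝓝 (D.pt 0)) →
      Tendsto (fun δ : ℝ => (δ : ℂ) * hexMidpoint (b δ)) (𝓝[>] 0) (𝓝 (D.pt 1)) →
      Tendsto (fun δ : ℝ =>
          (∑ γ : HexMidEdgeSAW (Λ' δ) (a δ) (b δ), hexCriticalFugacity ^ γ.length) /
            (∑ γ : HexMidEdgeSAW (Λ δ) (a δ) (b δ), hexCriticalFugacity ^ γ.length)) (𝓝[>] 0)
        (𝓝 (d ^ ((5 : ℝ) / 8)))) →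
    ∀ (Ω : Set ℂ) (s : ℕ → ℝ) (U : ℕ → Set HexVertex) (u v pu pv : ℕ → HexVertex) (x : ℕ → Site 2)
      (Λ'' : ℕ → Finset HexVertex) (E M : DobrushinDomain) (ρ : ℝ)
      (φ : ConformalEquiv upperHalfPlaneSet E.carrier)
      (Φ : ConformalEquiv (upperHalfPlaneSet \ φ.pullbackHull M) upperHalfPlaneSet) (d : ℝ)
      (N Λ' : ℝ → Finset HexVertex) (m₀ m₁ m₁' : ℝ → ℤ) (a b : ℝ → Sym2 HexVertex) (ε' : ℝ),
      Bornology.IsBounded Ω → Tendsto s atTop (𝓝[>] 0) →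
      (0 < ρ ∧ ∀ i : Fin 2, E.carrier ∩ ball (E.pt i) ρ = {z : ℂ | (E.pt i).im < z.im} ∩ ball (E.pt i) ρ) →
      E.IsHullSubdomain M → E.IsChordalUniformizing φ →
      IsRestrictionMap (φ.pullbackHull M) Φ → HasRestrictionDeriv (φ.pullbackHull M) Φ d →
      1 - ε' < d ^ ((5 : ℝ) / 8) →
      (∀ᶠ δ : ℝ in 𝓝[>] 0,
        Λ' δ ⊆ N δ ∧ hexDomainSimplyConnected (N δ) ∧ hexDomainSimplyConnected (Λ' δ) ∧
        (hexGraph.induce (↑(N δ) : Set HexVertex)).Preconnected ∧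
        (hexGraph.induce (↑(Λ' δ) : Set HexVertex)).Preconnected ∧
        a δ ∈ hexDomainBoundary (N δ) ∧ b δ ∈ hexDomainBoundary (N δ) ∧
        a δ ∈ hexDomainBoundary (Λ' δ) ∧ b δ ∈ hexDomainBoundary (Λ' δ) ∧
        Nonempty (HexMidEdgeSAW (Λ' δ) (a δ) (b δ)) ∧
        (∀ w ∈ N δ, (δ : ℂ) * hexCenter w ∈ E.carrier) ∧
        (∀ w ∈ Λ' δ, (δ : ℂ) * hexCenter w ∈ M.carrier) ∧
        (∀ w : HexVertex, (δ : ℂ) * hexCenter w ∈ ball (E.pt 0) ρ →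
          ((w ∈ N δ ↔ m₀ δ ≤ w.1 1) ∧ (w ∈ Λ' δ ↔ m₀ δ ≤ w.1 1))) ∧
        (∀ w : HexVertex, (δ : ℂ) * hexCenter w ∈ ball (E.pt 1) ρ →
          ((w ∈ N δ ↔ m₁ δ ≤ w.1 1) ∧ (w ∈ Λ' δ ↔ m₁' δ ≤ w.1 1)))) →
      (∀ K : Set ℂ, IsCompact K → K ⊆ E.carrier →
        ∀ᶠ δ : ℝ in 𝓝[>] 0, ∀ w : HexVertex, (δ : ℂ) * hexCenter w ∈ K → w ∈ N δ) →
      (∀ K : Set ℂ, IsCompact K → K ⊆ M.carrier →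
        ∀ᶠ δ : ℝ in 𝓝[>] 0, ∀ w : HexVertex, (δ : ℂ) * hexCenter w ∈ K → w ∈ Λ' δ) →
      Tendsto (fun δ : ℝ => (δ : ℂ) * hexMidpoint (a δ)) (𝓝[>] 0) (𝓝 (E.pt 0)) →
      Tendsto (fun δ : ℝ => (δ : ℂ) * hexMidpoint (b δ)) (𝓝[>] 0) (𝓝 (E.pt 1)) →
      (∀ᶠ j : ℕ in atTop,
        IsProbabilityMeasure (carvedLaw Ω (s j) (U j) (u j) (v j)) ∧
        (∀ w : HexVertex, w ∈ Λ'' j ↔ ((-(x j) + w.1, w.2) : HexVertex) ∈ Λ' (s j)) ∧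
        (∀ w ∈ Λ'' j, w ∉ U j) ∧
        (∀ w ∈ Λ'' j, ∀ y ∈ Λ'' j, hexGraph.Adj w y → (hexDomainGraph Ω (s j)).Adj w y) ∧
        u j ∈ Λ'' j ∧ pu j ∈ U j ∧ pv j ∈ U j ∧ hexGraph.Adj (u j) (pu j) ∧
        s(u j, pu j) ≠ s(v j, pv j) ∧
        (a (s j)).map (fun w : HexVertex => ((x j + w.1, w.2) : HexVertex)) = s(u j, pu j) ∧
        (b (s j)).map (fun w : HexVertex => ((x j + w.1, w.2) : HexVertex)) = s(v j, pv j) ∧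
        (∀ (w : HexVertex) (π : (hexDomainGraph Ω (s j)).Walk (u j) w),
          (∀ y ∈ π.support, y ∉ U j) →
            ∀ y ∈ π.support, ((-(x j) + y.1, y.2) : HexVertex) ∈ N (s j)) ∧
        ((-(x j) + (pu j).1, (pu j).2) : HexVertex) ∉ N (s j) ∧
        ((-(x j) + (pv j).1, (pv j).2) : HexVertex) ∉ N (s j)) →
      ∀ᶠ j : ℕ in atTop, 1 - ε' ≤
        (carvedLaw Ω (s j) (U j) (u j) (v j) {ξ | ∀ w ∈ ξ.walk.support, w ∈ Λ'' j}).toReal := by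
  intro hARL Ω s U u v pu pv x Λ'' E M ρ φ Φ d N Λ' m₀ m₁ m₁' a b ε' hΩ hs hflat hM hφ hΦ hd hlev
    hadm hexhE hexhM ha hb hcell
  -- ARL″ once: the ratio `Z_{Λ'}/Z_N → d^{5/8}` along `𝓝[>] 0`, hence along the mesh sequence
  have hratio := (hARL E M ρ φ Φ d N Λ' m₀ m₁ m₁' a b hflat hM hφ hΦ hd hadm hexhE hexhM ha hb).comp hs
  have hgt : ∀ᶠ j : ℕ in atTop, 1 - ε' <
      (∑ γ : HexMidEdgeSAW (Λ' (s j)) (a (s j)) (b (s j)), hexCriticalFugacity ^ γ.length) /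
        (∑ γ : HexMidEdgeSAW (N (s j)) (a (s j)) (b (s j)), hexCriticalFugacity ^ γ.length) :=
    hratio.eventually (lt_mem_nhds hlev)
  have hspos : ∀ᶠ j : ℕ in atTop, 0 < s j :=
    hs.eventually (eventually_mem_nhdsWithin (a := (0 : ℝ)) (s := Ioi 0))
  filter_upwards [hgt, hspos, hcell] with j hj hsj hc
  obtain ⟨hprob, hrel, hΛS, hedge, hu, hpu, hpv, hadj, hne, hmapa, hmapb, hwalk, hpuN, hpvN⟩ := hc
  -- the translated outer vertex set
  set Nx : Finset HexVertex :=
    (N (s j)).map ⟨fun w : HexVertex => ((x j + w.1, w.2) : HexVertex), translate_injective (x j)⟩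
    with hNx
  have hrelN : ∀ w : HexVertex, w ∈ Nx ↔ ((-(x j) + w.1, w.2) : HexVertex) ∈ N (s j) := by
    intro w
    rw [hNx, Finset.mem_map]
    constructor
    · rintro ⟨y, hy, rfl⟩
      simpa using hy
    · intro hw
      refine ⟨((-(x j) + w.1, w.2) : HexVertex), hw, ?_⟩
      obtain ⟨c, k⟩ := w
      simp
  have hN : ∀ (w : HexVertex) (π : (hexDomainGraph Ω (s j)).Walk (u j) w),
      (∀ y ∈ π.support, y ∉ U j) → ∀ y ∈ π.support, y ∈ Nx :=
    fun w π hπ y hy => (hrelN y).2 (hwalk w π hπ y hy)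
  have huN : u j ∈ Nx := by
    refine hN (u j) SimpleGraph.Walk.nil (fun y hy => ?_) (u j) (by simp)
    rw [SimpleGraph.Walk.support_nil, List.mem_singleton] at hy
    rw [hy]
    exact hΛS _ hu
  have hpuNx : pu j ∉ Nx := fun h => hpuN ((hrelN _).1 h)
  have hpvNx : pv j ∉ Nx := fun h => hpvN ((hrelN _).1 h)
  have hfin : Finite (HexDomainSAW Ω (s j) (u j) (v j)) := finite_hexDomainSAW hΩ hsj.ne' _ _
  have hsand := stub_carvedReduction_sandwich Ω (s j) (U j) (Λ'' j) Nx (Λ' (s j)) (N (s j)) (u j) (v j)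
    (pu j) (pv j) (x j) (a (s j)) (b (s j)) hfin hprob hΛS hedge hu hpu hpv hadj hne hN huN hpuNx hpvNx
    hrel hrelN hmapa hmapb
  exact hj.le.trans hsand

end Summit.CriticalPhenomena.SAWScalingLimit.Theorems.ObservableToSLE.TypeLadder

end
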